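import Literature.NumberTheory.GaloisRepresentations.WeilDeligneOfGalois
import Literature.NumberTheory.GaloisRepresentations.WeilGroupFrobeniusPowers
import Literature.NumberTheory.GaloisRepresentations.WeilDeligneOfGaloisUnramifiedProofs
import Literature.NumberTheory.GaloisRepresentations.GaloisRep
import Literature.RepresentationTheory.Semisimple.BurnsideMatrixSpan
import Literature.LinearAlgebra.BaseChange.LinearIndependentFieldExtension
import Literature.LinearAlgebra.Matrix.NilpotentExpInjective
import Summits.Langlands.Langlands.Theorems.IrreducibilityBySelfDualityIrreducibleOffSectorWDIrreducibleBasics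
import HarnessLib

/-!
# A1-ind: SEMISIMPLE `ρ` with an INDECOMPOSABLE attached Weil–Deligne representation is irreducible
(crux stmt-Langlands-14329 `IrreducibilityBySelfDuality.IrreducibleOffSector`, supports kit
`square-integrable-place` §1; `--supports` file, lead a1's own stub; STRUCTURAL: Literature imports only)

Taylor–Yoshida Cor 1.3 mechanism: a `Γ_K`-stable decomposition `ρ = ρ₁ ⊕ ρ₂` (semisimplicity) is a
decomposition into sub-Weil–Deligne representations of any `r = (ρ_WD, N)` attached to
`ρ|_{Γ_{K_v}}`: `N`-stability because `ρ(u) = exp(t(u) N)` on an open subgroup of inertia with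
`t(u₀) ≠ 0` — stability under `exp(k·a·N)` for `k = 0, …` gives stability under `N` by a
Vandermonde inversion — and then `ρ_WD(Φ^m u) = ρ(Φ^m u) exp(−t(u) N)` preserves it too.
Reference: Taylor–Yoshida, arXiv:math/0412357, Cor. 1.3 (proof); Tate, Corvallis 1979, (4.2.1).
-/

noncomputable section

set_option linter.dupNamespace false

open scoped MatrixGroups Matrix NumberField
open Module IsDedekindDomain
open Literature.NumberTheory.GaloisRepresentations
open Literature.NumberTheory.GaloisRepresentations.WeilGroup

namespace Summit.Langlands.Langlands.Theorems.IrreducibleOffSector.SquareIntegrablePlace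


/-! ### Matrix lemmas: stability under `exp (k • A)` for all `k ∈ ℕ` gives stability under `A` -/

/-- Powers of a matrix preserving a subspace preserve it. [folklore] -/
theorem pow_mulVec_mem {E : Type*} [CommRing E] {n : ℕ} (p : Submodule E (Fin n → E))
    {A : Matrix (Fin n) (Fin n) E} (h : ∀ x ∈ p, A *ᵥ x ∈ p) (i : ℕ) :
    ∀ x ∈ p, A ^ i *ᵥ x ∈ p := by
  induction i with
  | zero =>
    intro x hx
    simpa using hx
  | succ i ih =>
    intro x hx
    rw [pow_succ, ← Matrix.mulVec_mulVec]
    exact ih _ (h x hx)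

/-- `exp (c • A)` preserves every subspace preserved by the nilpotent matrix `A` (it is a polynomial
in `A`). [folklore] -/
theorem exp_smul_mulVec_mem {E : Type*} [Field E] [CharZero E] {n : ℕ} (p : Submodule E (Fin n → E))
    {A : Matrix (Fin n) (Fin n) E} (hA : IsNilpotent A) (h : ∀ x ∈ p, A *ᵥ x ∈ p) (c : E) :
    ∀ x ∈ p, IsNilpotent.exp (c • A) *ᵥ x ∈ p := by
  obtain ⟨M, hM⟩ := hA
  intro x hx
  rw [Literature.LinearAlgebra.Matrix.exp_smul_eq_sum hM c, Matrix.sum_mulVec]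
  refine Submodule.sum_mem _ fun i _ => ?_
  rw [Matrix.smul_mulVec, Matrix.smul_mulVec]
  exact Submodule.smul_mem _ _ (Submodule.smul_mem _ _ (pow_mulVec_mem p h i x hx))

/-- **Vandermonde step.** If a subspace `p` is stable under `exp (k • A)` for every `k ∈ ℕ`
(`A` nilpotent, characteristic zero), then it is stable under `A`: with `A ^ M = 0`,
`exp (k • A) = ∑_{i<M} kⁱ Cᵢ`, `Cᵢ = Aⁱ / i!`, and the Vandermonde matrix `(kⁱ)_{k,i<M}` is
invertible, so `A = C₁` is a linear combination of the `exp (k • A)`, `k < M`. [folklore] -/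
theorem mulVec_mem_of_forall_exp_natCast_smul {E : Type*} [Field E] [CharZero E] {n : ℕ}
    (p : Submodule E (Fin n → E)) {A : Matrix (Fin n) (Fin n) E} (hA : IsNilpotent A)
    (h : ∀ k : ℕ, ∀ x ∈ p, IsNilpotent.exp ((k : E) • A) *ᵥ x ∈ p) :
    ∀ x ∈ p, A *ᵥ x ∈ p := by
  classical
  obtain ⟨M₀, hM₀⟩ := hA
  obtain ⟨M, hM, h1⟩ : ∃ M : ℕ, A ^ M = 0 ∧ 1 < M :=
    ⟨M₀ + 2, by rw [pow_add, hM₀, zero_mul], by omega⟩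
  -- the coefficients `Cᵢ = Aⁱ / i!`
  set C : ℕ → Matrix (Fin n) (Fin n) E := fun i => ((i.factorial : E)⁻¹) • A ^ i with hC
  have hexp : ∀ k : ℕ, IsNilpotent.exp ((k : E) • A) = ∑ i : Fin M, ((k : E) ^ (i : ℕ)) • C i := by
    intro k
    rw [Literature.LinearAlgebra.Matrix.exp_smul_eq_sum hM (k : E), Finset.sum_range]
  -- the Vandermonde matrix at the nodes `0, 1, …, M-1`
  set V : Matrix (Fin M) (Fin M) E := Matrix.vandermonde (fun k : Fin M => ((k : ℕ) : E)) with hV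
  have hVdet : IsUnit V.det := by
    rw [isUnit_iff_ne_zero, hV, Matrix.det_vandermonde_ne_zero_iff]
    intro a b hab
    exact Fin.ext (Nat.cast_injective hab)
  have hinv : V⁻¹ * V = 1 := Matrix.nonsing_inv_mul V hVdet
  have hVapply : ∀ k j : Fin M, V k j = ((k : ℕ) : E) ^ (j : ℕ) := fun k j => by
    simp [hV, Matrix.vandermonde]
  -- inversion: `C i = ∑_k V⁻¹ i k • exp (k • A)`
  have key : ∀ i : Fin M, C i = ∑ k : Fin M, V⁻¹ i k • ∑ j : Fin M, (((k : ℕ) : E) ^ (j : ℕ)) • C j := by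
    intro i
    simp_rw [← hVapply, Finset.smul_sum, smul_smul]
    rw [Finset.sum_comm]
    simp_rw [← Finset.sum_smul, ← Matrix.mul_apply, hinv, Matrix.one_apply, ite_smul, one_smul,
      zero_smul, Finset.sum_ite_eq, Finset.mem_univ, if_true]
  intro x hx
  have hC1 : A = C (⟨1, h1⟩ : Fin M) := by simp [hC]
  rw [hC1, key ⟨1, h1⟩, Matrix.sum_mulVec]
  refine Submodule.sum_mem _ fun k _ => ?_
  rw [Matrix.smul_mulVec, ← hexp k]
  exact Submodule.smul_mem _ _ (h k x hx)

/-! ### Subrepresentations of `ρ` are sub-Weil–Deligne representations of `WD(ρ|_{Γ_{K_v}})` -/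

/-- **A `Γ_K`-stable subspace is a sub-Weil–Deligne representation of any `r = (ρ_WD, N)` attached to
`ρ|_{Γ_{K_v}}` by the Grothendieck–Deligne recipe.**  Stability under `ρ(W_{K_v})` is clear;
`N`-stability: `ρ(u₀ᵏ) = exp (k · t(u₀) · N)` for the element `u₀` of the recipe (`t(u₀) ≠ 0`) and
all `k ∈ ℕ`, so the Vandermonde step applies; finally `ρ_WD(Φ^m u) = ρ(Φ^m u) · exp (−t(u) N)` and
every `w ∈ W_{K_v}` is of this form. [cite: TateCorvallis1979, (4.2.1)] [cite: DeligneAntwerpII1973, §8.4.2] -/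
theorem isSubrep_toSubmodule_of_isWeilDeligneOfLadic {K : Type} [Field K] [NumberField K] {n ℓ : ℕ}
    [Fact ℓ.Prime] (ρ : FramedGaloisRep K (PadicAlgCl ℓ) n) (v : HeightOneSpectrum (𝓞 K))
    (r : WeilDeligneRep (v.adicCompletion K) (PadicAlgCl ℓ) (Fin n → PadicAlgCl ℓ))
    (hr : IsWeilDeligneOfLadic (ρ.toLocal v).toWeilGroupHom r)
    (W : Subrepresentation (FramedRep.toRepresentation ρ)) : r.IsSubrep W.toSubmodule := by
  set p := W.toSubmodule with hp
  -- (a) `p` is stable under `ρ(w)` for every `w ∈ W_{K_v}`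
  have hG : ∀ (w : WeilGroup (v.adicCompletion K)), ∀ x ∈ p,
      (((ρ.toLocal v).toWeilGroupHom w : GL (Fin n) (PadicAlgCl ℓ)) :
        Matrix (Fin n) (Fin n) (PadicAlgCl ℓ)) *ᵥ x ∈ p := by
    intro w x hx
    have hmem := W.apply_mem_toSubmodule
      (absGaloisRestrict K (v.adicCompletion K) (WeilGroup.toAbsGalois (v.adicCompletion K) w)) hx
    simpa [FramedRep.toWeilGroupHom_apply, FramedGaloisRep.toLocal_apply] using hmem
  obtain ⟨t, U, Φ, -, -, hΦ, ⟨u₀, hu₀U, ht₀⟩, h2, h3⟩ := hr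
  set Nm : Matrix (Fin n) (Fin n) (PadicAlgCl ℓ) := LinearMap.toMatrix' r.N with hNm
  have hNnil : IsNilpotent Nm := r.isNilpotent_N.map LinearMap.toMatrixAlgEquiv'
  set a : PadicAlgCl ℓ := (t u₀).toAdd with ha
  have ha0 : a ≠ 0 := fun h => ht₀ (by rw [← ofAdd_toAdd (t u₀), ← ha, h, ofAdd_zero])
  -- (b) `N`-stability, by the Vandermonde step at the elements `u₀ ^ k`
  have hN : ∀ x ∈ p, Nm *ᵥ x ∈ p := by
    have hexpk : ∀ k : ℕ, ∀ x ∈ p,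
        IsNilpotent.exp ((k : PadicAlgCl ℓ) • (a • Nm)) *ᵥ x ∈ p := by
      intro k x hx
      have hk : ((u₀ ^ k : WeilGroup.inertia (v.adicCompletion K)) :
          WeilGroup (v.adicCompletion K)) ∈ U := by
        rw [Subgroup.coe_pow]
        exact U.pow_mem hu₀U k
      have hmat := h2 (u₀ ^ k) hk
      rw [map_pow, toAdd_pow, ← ha, nsmul_eq_mul, mul_smul] at hmat
      have hx' := hG (u₀ ^ k : WeilGroup.inertia (v.adicCompletion K)) x hx
      rwa [hmat] at hx'
    have hA := mulVec_mem_of_forall_exp_natCast_smul p (hNnil.smul a) hexpk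
    intro x hx
    have hax := hA x hx
    rw [Matrix.smul_mulVec] at hax
    exact (Submodule.smul_mem_iff p ha0).mp hax
  refine ⟨fun w x hx => ?_, fun x hx => ?_⟩
  · -- (c) stability under `ρ_WD(w)`, `w = Φ^{-deg w} · (Φ^{deg w} w)`
    rw [Submodule.mem_comap]
    have hmem : Φ ^ (WeilGroup.deg w) * w ∈ WeilGroup.inertia (v.adicCompletion K) :=
      WeilGroup.zpow_deg_mul_mem_inertia hΦ w
    have key := h3 (-WeilGroup.deg w) ⟨Φ ^ (WeilGroup.deg w) * w, hmem⟩
    have hw : Φ ^ (-WeilGroup.deg w) * (Φ ^ (WeilGroup.deg w) * w) = w := by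
      rw [← mul_assoc, zpow_neg, inv_mul_cancel, one_mul]
    simp only [hw] at key
    rw [← LinearMap.toMatrix'_mulVec (r.ρ w) x, key, ← Matrix.mulVec_mulVec]
    refine hG w _ ?_
    rw [← neg_smul]
    exact exp_smul_mulVec_mem p hNnil hN _ x hx
  · rw [Submodule.mem_comap, ← LinearMap.toMatrix'_mulVec r.N x]
    exact hN x hx

/-- **A1-ind (Taylor–Yoshida Cor 1.3 mechanism; semisimplicity load-bearing).** If `ρ` is SEMISIMPLE
and a Weil–Deligne representation attached to `ρ|_{Γ_{K_v}}` is INDECOMPOSABLE, then `ρ` is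
irreducible: a complemented pair of subrepresentations is a complemented pair of sub-Weil–Deligne
representations (`isSubrep_toSubmodule_of_isWeilDeligneOfLadic`). [cite: TaylorYoshida2007, Cor. 1.3] -/
theorem isIrreducible_of_isIndecomposable_weilDeligne {K : Type} [Field K] [NumberField K] {n ℓ : ℕ}
    [Fact ℓ.Prime]
    (ρ : FramedGaloisRep K (PadicAlgCl ℓ) n) (hss : ρ.toGaloisRep.IsSemisimple)
    (v : HeightOneSpectrum (𝓞 K))
    (r : WeilDeligneRep (v.adicCompletion K) (PadicAlgCl ℓ) (Fin n → PadicAlgCl ℓ))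
    (hr : IsWeilDeligneOfLadic (ρ.toLocal v).toWeilGroupHom r) (hind : r.IsIndecomposable) :
    ρ.toGaloisRep.IsIrreducible := by
  haveI : Nontrivial (Fin n → PadicAlgCl ℓ) := hind.1
  change (FramedRep.toRepresentation ρ).IsIrreducible
  have hss' : ComplementedLattice (Subrepresentation (FramedRep.toRepresentation ρ)) := hss
  have hb : (⊥ : Subrepresentation (FramedRep.toRepresentation ρ)).toSubmodule = ⊥ := rfl
  have ht : (⊤ : Subrepresentation (FramedRep.toRepresentation ρ)).toSubmodule = ⊤ := rfl
  haveI : Nontrivial (Subrepresentation (FramedRep.toRepresentation ρ)) := ⟨⟨⊥, ⊤, fun e => by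
    have e' := congrArg Subrepresentation.toSubmodule e
    rw [hb, ht] at e'
    exact bot_ne_top e'⟩⟩
  refine ⟨fun W => ?_⟩
  obtain ⟨W', hW⟩ := hss'.exists_isCompl W
  have hc : IsCompl W.toSubmodule W'.toSubmodule := by
    refine ⟨?_, ?_⟩
    · rw [disjoint_iff]
      have h' := congrArg Subrepresentation.toSubmodule (disjoint_iff.mp hW.disjoint)
      rwa [Subrepresentation.toSubmodule_inf, hb] at h'
    · rw [codisjoint_iff]
      have h' := congrArg Subrepresentation.toSubmodule (codisjoint_iff.mp hW.codisjoint)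
      rwa [Subrepresentation.toSubmodule_sup, ht] at h'
  rcases hind.2 _ _ (isSubrep_toSubmodule_of_isWeilDeligneOfLadic ρ v r hr W)
      (isSubrep_toSubmodule_of_isWeilDeligneOfLadic ρ v r hr W') hc with h | h
  · exact Or.inl (Subrepresentation.toSubmodule_injective (by rw [h, hb]))
  · right
    have hW' : W' = ⊥ := Subrepresentation.toSubmodule_injective (by rw [h, hb])
    rw [hW'] at hW
    exact eq_top_of_isCompl_bot hW

end Summit.Langlands.Langlands.Theorems.IrreducibleOffSector.SquareIntegrablePlace

end
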